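import Summits.BirchSwinnertonDyer.BirchSwinnertonDyer.Theorems.ResidualThetaTransportAtTwoCompactRankAlgebra
import Summits.BirchSwinnertonDyer.BirchSwinnertonDyer.Theorems.ResidualThetaTransportAtTwoSignedLayerCorankBound
import Summits.BirchSwinnertonDyer.BirchSwinnertonDyer.Theorems.ResidualThetaTransportAtTwoLayerH1TorsionFree
import Summits.BirchSwinnertonDyer.BirchSwinnertonDyer.Theorems.KatoDescentPotSupersingularKatoFiniteLevelStrictCompactKernel
import Summits.BirchSwinnertonDyer.BirchSwinnertonDyer.Theorems.KolyvaginRankRigidityAtTwoCorankFromFiniteLevels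
import Literature.NumberTheory.EllipticCurves.Kato2004.IwasawaH1ReductionSeparated
import Literature.NumberTheory.EllipticCurves.AnticyclotomicSignedCompactSelmer
import Literature.NumberTheory.EllipticCurves.SelmerCorankControlRatProofs
import HarnessLib

/-!
# Input (Λ3)-compact of the `Λ`-adic road to SURJ⁺@2 (item 23110 at every rank), COHOMOLOGICAL half:
# `rank_{ℤ_p} S ≤ corank_{ℤ_p} Sel` for every `ℤ_p`-submodule `S ⊆ H¹(U, T_pE)` whose reductions modulo `p^k` land in a
# `p`-primary `Sel ⊆ H¹(U, E[p^∞])` with finite `p`-torsion — hence `rank_{ℤ₂} 𝔖⁺(E/ℚ_n) ≤ corank_{ℤ₂} Sel⁺(E/ℚ_n) ≤ λ⁺`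

Routes `ResidualThetaTransportAtTwo` (RTT, crux r201 `ResidualLambdaFormulaNegDiscAtTwo`, stmt-BirchSwinnertonDyer-23110) /
`ThetaPartnerAtTwo` (K1 `stub_surj2`; K3 aside). Seat `prover-bsd-wall-tp2-p2x-w3` g12 (width of the K3 lead tp2-p2x g12, who holds
23110); `--supports stmt-BirchSwinnertonDyer-23110`. THEOREMS ONLY (no definition, no named fact, no `sorry`); closes nothing.

WHY (memo ALL-RANK-RLF-ROADS-w4g0 §4 (Λ3), seat rtt-w4; `…UniversalNormTowerVanishing`, seat tp2-p2x-w2 g14). The tower-vanishing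
engine needs a UNIFORM bound on the `ℤ_p`-ranks of the `conj_γ`-stable submodules `S n ⊆ H¹(ℚ_n, T_pE)` carrying the
norm-compatible families — the compact signed Selmer layers `𝔖⁺(E/ℚ_n)`; the tree bounds the CORANK of the DISCRETE layers,
`zpCorank Sel⁺(E/ℚ_n) ≤ λ(X⁺)` (`TowerVanishing.zpCorank_signedSelmerLayer_le_lambda[_of_goodSS]`, p645699). THIS FILE is the
comparison «rank of the compact group ≤ corank of the discrete group», in the Kato currency `H1 (tateRep W p) U` of the engine and
for an ARBITRARY level `U ≤ Γ_ℚ` and an ARBITRARY target subgroup `Sel`; the compact layers enter only through the hypothesis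
«the reductions `red_{p^k} x`, pushed along `E[p^k] ↪ E[p^∞]`, lie in `Sel`», so that any definition of `𝔖⁺(E/ℚ_n)` by finite-level
signed conditions whose images lie in `Sel⁺(E/ℚ_n)` inherits the bound. (The sibling files `…SeparatedLatticeRank` / `…CompactLayerRankBound` of seat w2 g14
bound the number of independent classes by `log_p #A[p]` for an abstract injective `ι_k`; here the bound is the CORANK, through the
growth `#Sel[p^k] ≤ D · p^{(corank) k}`, and `ι_k` is the concrete push-forward along `E[p^k] ↪ E[p^∞]`, whose injectivity is proved.)

INPUTS, all tree theorems: `ker (red_{p^k} : H¹(U, T_pE) → H¹(U, E[p^k])) = p^k H¹(U, T_pE)`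
(`KatoFiniteLevelCount.reduceH1Pk_eq_zero_iff`, Kato §13.8); `⋂_k p^k H¹(U, T_pE) = 0` (`Kato2004.eq_zero_of_forall_mem_pow_smul`,
Rubin App. B Prop. B.2.3); the growth `#A[p^k] ≤ D · p^{(zpCorank A) k}` of a `p`-primary group with finite `p`-torsion
(`KolyvaginRankRigidity.exists_natCard_torsionBy_pow_le`, Greenberg LNM 1716 §1); the pure-algebra lemma
`CompactRank.rank_le_of_card_image_le` (`…CompactRankAlgebra`: compactness of `ℤ_p^{B+1}`); and, proved here on cocycles, the
injectivity of `H¹(U, E[p^k]) → H¹(U, E[p^∞])` when `E[p^∞]` has no non-zero `U`-fixed point.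

* `pow_smul_torsionH1_eq_zero` — `p^k` kills `H¹(U, E[p^k])`;
* `torsionToPrimaryH1_injective_of_forall_fixed_eq_zero` — `H¹(U, E[p^k]) ↪ H¹(U, E[p^∞])` if `E[p^∞]^U = 0`;
* `rank_le_zpCorank_of_forall_reduceH1Pk_mem` — THE COMPARISON: `U ≤ Γ_ℚ`, `H¹(U, T_pE)` without `p`-torsion, `E[p^∞]^U = 0`,
  `S ⊆ H¹(U, T_pE)` a `ℤ_p`-submodule, `Sel ≤ H¹(U, E[p^∞])` `p`-primary with `Sel[p]` finite, all pushed reductions of `S` in `Sel`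
  ⟹ `Module.rank ℤ_[p] S ≤ zpCorank Sel p`;
* `rank_le_zpCorank_of_forall_reduceH1Pk_mem_layer` — the layers `U = Gal(ℚ̄/ℚ_n)` of a `ℤ_p`-extension with `E(ℚ_∞)[p^∞] = 0`
  (both torsion hypotheses discharged: `TowerVanishing.layerH1_eq_zero_of_pow_smul_eq_zero_of_fixedPoints_eq_bot`, p645404);
* `finite_torsionBy_signedSelmerLayer` — `Sel^ε(E/K_n)[p]` is finite for a torsion signed dual datum with `μ = 0` and `E(K)[p] = 0`
  (it embeds in `Sel^ε(E/K_∞)[p]`, `SignedTransportAtTwo.finite_torsionBy_signedSelmerInfty`);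
* `rank_le_lambda_of_forall_reduceH1Pk_mem_signedSelmerLayer_of_goodSS` — `p = 2`, `E/ℚ` globally minimal good supersingular at `2`,
  any `ℤ₂`-extension with topological generator, `+` dual datum torsion with `μ = 0`: every `S ⊆ H¹(ℚ_n, T₂E)` reducing into
  `Sel⁺(E/ℚ_n)` has `rank_{ℤ₂} S ≤ λ(X⁺)` — input (Λ3) of `forall_eq_zero_of_layerCores_eq_of_mem_of_rank_le_of_goodSS` with
  `B = λ⁺`, for every such family `S n`.

HONEST FRAMING: closes nothing; 23110 is NOT proved; BSD is not proved by any of this.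
References: [GreenbergVatsal2000] §2 Prop. (2.1); [GreenbergLNM1716] §1 p. 60, §3 Lemma 3.1; [Kato2004Asterisque] §8.2 (p. 180),
§13.8 (p. 228); [Rubin2000] App. B Prop. B.2.3; [Kobayashi2003] Def. 1.1; [SerreGaloisCohomology1997] I §2.2, I §5.
-/

set_option autoImplicit false
-- D-0017: single-problem summit, so `Summit.BirchSwinnertonDyer.BirchSwinnertonDyer.…` repeats a namespace BY DESIGN.
set_option linter.dupNamespace false

noncomputable section

open scoped Classical AddSubgroup
open Field CategoryTheory
open Literature.NumberTheory.GaloisRepresentations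
open Literature.NumberTheory.EllipticCurves Literature.NumberTheory.EllipticCurves.Kato2004
open Literature.NumberTheory.EllipticCurves.Kato2004.EulerSystemValues
open Literature.NumberTheory.EllipticCurves.Kobayashi2003
open WeierstrassCurve (geomPoints geomTorsion geomPrimaryTorsion)

universe u

namespace Summit.BirchSwinnertonDyer.BirchSwinnertonDyer.Theorems.ResidualThetaLayer.CompactRank

section General

variable (W : WeierstrassCurve ℚ) [W.IsElliptic] (p : ℕ) [hp : Fact p.Prime]

omit [W.IsElliptic] hp in
/-- **`p^k` kills `E[p^k]`** (pointwise, for the integer level `(p : ℤ)^k` of the Kato files). [folklore] -/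
theorem pow_smul_geomTorsion_zpow_eq_zero (k : ℕ) (P : geomTorsion W ((p : ℤ) ^ k)) : p ^ k • P = 0 :=
  Subtype.ext (by
    rw [AddSubgroupClass.coe_nsmul, ZeroMemClass.coe_zero, ← natCast_zsmul, Nat.cast_pow]
    exact (W.mem_geomTorsion_iff _ _).mp P.2)

omit [W.IsElliptic] hp in
/-- **`p^k` kills `H¹(U, E[p^k])`**: a class is the class of a continuous cocycle, killed by `p^k` pointwise
(`nsmul_oneCocycleClass_eq_zero`). [cite: SerreGaloisCohomology1997, I §2.2] [folklore] -/
theorem pow_smul_torsionH1_eq_zero (U : Subgroup (absoluteGaloisGroup ℚ)) (k : ℕ)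
    (c : subgroupH1 U (geomTorsion W ((p : ℤ) ^ k))) : p ^ k • c = 0 := by
  obtain ⟨φ, rfl⟩ := oneCocycleClass_surjective _ c
  exact nsmul_oneCocycleClass_eq_zero φ (p ^ k) fun g ↦ pow_smul_geomTorsion_zpow_eq_zero W p k (φ.1 g)

omit [W.IsElliptic] hp in
/-- **`H¹(U, E[p^k]) → H¹(U, E[p^∞])` is injective when `E[p^∞]` has no non-zero `U`-fixed point.** On cocycles: if
`ι ∘ φ = ∂b` with `b ∈ E[p^∞]`, then `∂(p^k b) = p^k (ι ∘ φ) = 0`, so `p^k b` is `U`-fixed, hence `0`; thus `b ∈ E[p^k]` and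
`φ = ∂b` already in `E[p^k]`. (Greenberg's remark that `H¹(F_n, E[p]) → H¹(F_n, E[p^∞])` is injective once `E(F_n)[p] = 0`.)
[cite: GreenbergLNM1716, §3 Lemma 3.1 and §5 p. 114] [cite: SerreGaloisCohomology1997, I §5] -/
theorem torsionToPrimaryH1_injective_of_forall_fixed_eq_zero (U : Subgroup (absoluteGaloisGroup ℚ)) (k : ℕ)
    (hfix : ∀ P : W.geomPrimaryTorsion p, (∀ g ∈ U, g • P = P) → P = 0) :
    Function.Injective (resH1Hom (N := W.geomPrimaryTorsion p) (ContinuousMonoidHom.id U)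
      (AddSubgroup.inclusion (AcSigned.geomTorsion_zpow_le_geomPrimaryTorsion W p k)) (fun _ _ ↦ rfl) :
      subgroupH1 U (geomTorsion W ((p : ℤ) ^ k)) →+ W.subgroupH1 p U) := by
  set ι : geomTorsion W ((p : ℤ) ^ k) →+ W.geomPrimaryTorsion p :=
    AddSubgroup.inclusion (AcSigned.geomTorsion_zpow_le_geomPrimaryTorsion W p k) with hι
  have hιinj : Function.Injective ι := AddSubgroup.inclusion_injective _
  refine (injective_iff_map_eq_zero _).mpr fun c hc ↦ ?_
  obtain ⟨φ, rfl⟩ := oneCocycleClass_surjective _ c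
  rw [resH1Hom_id_oneCocycleClass, oneCocycleClass_eq_zero_iff] at hc
  obtain ⟨b, hb⟩ := hc
  have hb' : ∀ g : U, ι (φ.1 g) = (g : absoluteGaloisGroup ℚ) • b - b := fun g ↦ hb g
  -- `p^k b` is `U`-fixed, hence `0`
  have hpk : p ^ k • b = 0 := by
    refine hfix _ fun g hg ↦ ?_
    have h1 : p ^ k • ι (φ.1 ⟨g, hg⟩) = 0 := by
      rw [← map_nsmul, pow_smul_geomTorsion_zpow_eq_zero, map_zero]
    rw [hb' ⟨g, hg⟩, smul_sub, smul_comm, sub_eq_zero] at h1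
    exact h1
  -- so `b ∈ E[p^k]`, `b = ι b'`
  have hbmem : (b : geomPoints W) ∈ geomTorsion W ((p : ℤ) ^ k) := by
    refine (W.mem_geomTorsion_iff _ _).mpr ?_
    rw [← Nat.cast_pow, natCast_zsmul, ← AddSubgroupClass.coe_nsmul, hpk, ZeroMemClass.coe_zero]
  have hιb : ι ⟨(b : geomPoints W), hbmem⟩ = b := Subtype.ext rfl
  rw [oneCocycleClass_eq_zero_iff]
  refine ⟨⟨(b : geomPoints W), hbmem⟩, fun g ↦ hιinj ?_⟩
  rw [hb' g, map_sub, hιb]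
  rfl

variable [ContinuousSMul ℤ_[p] (W.tateModule p)]

/-- **THE COMPARISON `rank_{ℤ_p} S ≤ corank_{ℤ_p} Sel`.** Let `U ≤ Γ_ℚ`; assume `H¹(U, T_pW)` has no `p`-torsion and `E[p^∞]`
no non-zero `U`-fixed point. Let `S ⊆ H¹(U, T_pW)` be a `ℤ_p`-submodule and `Sel ≤ H¹(U, E[p^∞])` a `p`-primary subgroup with
`Sel[p]` finite such that for every `k` and `x ∈ S` the reduction `red_{p^k} x ∈ H¹(U, E[p^k])`, pushed into `H¹(U, E[p^∞])`,
lies in `Sel`. Then `Module.rank ℤ_[p] S ≤ zpCorank Sel p`. PROOF: `CompactRank.rank_le_of_card_image_le` with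
`f_k = ι_* ∘ red_{p^k}`, `T_k = Sel ∩ (p^k‑torsion)` (`#T_k ≤ #Sel[p^k] ≤ D · p^{(corank) k}`), `ker f_k = p^k H¹(U, T_pW)`
(`reduceH1Pk_eq_zero_iff` + injectivity of `ι_*`), and the separatedness `⋂ p^k H¹(U, T_pW) = 0`.
[cite: GreenbergVatsal2000, §2 Prop. (2.1)] [cite: GreenbergLNM1716, §1 p. 60] [cite: Kato2004Asterisque, §13.8 (p. 228)]
[cite: Rubin2000, App. B Prop. B.2.3] -/
theorem rank_le_zpCorank_of_forall_reduceH1Pk_mem (U : Subgroup (absoluteGaloisGroup ℚ))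
    (htf : ∀ (k : ℕ) (y : H1 (tateRep W p) U), ((p : ℤ_[p]) ^ k) • y = 0 → y = 0)
    (hfix : ∀ P : W.geomPrimaryTorsion p, (∀ g ∈ U, g • P = P) → P = 0)
    (S : Submodule ℤ_[p] (H1 (tateRep W p) U)) (Sel : AddSubgroup (W.subgroupH1 p U))
    (hSel : ∀ s : Sel, ∃ n : ℕ, p ^ n • s = 0) [Finite (↥Sel)[(p : ℤ)]]
    (hmem : ∀ (k : ℕ) (x : H1 (tateRep W p) U), x ∈ S →
      resH1Hom (N := W.geomPrimaryTorsion p) (ContinuousMonoidHom.id U)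
        (AddSubgroup.inclusion (AcSigned.geomTorsion_zpow_le_geomPrimaryTorsion W p k)) (fun _ _ ↦ rfl)
        (reduceH1Pk W p k U x) ∈ Sel) :
    Module.rank ℤ_[p] S ≤ zpCorank Sel p := by
  -- the maps `f k = ι_* ∘ red_{p^k}` on `S`
  let ι : ∀ k : ℕ, subgroupH1 U (geomTorsion W ((p : ℤ) ^ k)) →+ W.subgroupH1 p U := fun k ↦
    resH1Hom (N := W.geomPrimaryTorsion p) (ContinuousMonoidHom.id U)
      (AddSubgroup.inclusion (AcSigned.geomTorsion_zpow_le_geomPrimaryTorsion W p k)) (fun _ _ ↦ rfl)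
  have hιinj : ∀ k, Function.Injective (ι k) := fun k ↦
    torsionToPrimaryH1_injective_of_forall_fixed_eq_zero W p U k hfix
  let f : ∀ k : ℕ, S →+ W.subgroupH1 p U := fun k ↦
    ((ι k).comp (reduceH1Pk W p k U)).comp S.subtype.toAddMonoidHom
  have hf_apply : ∀ (k : ℕ) (x : S), f k x = ι k (reduceH1Pk W p k U (x : H1 (tateRep W p) U)) :=
    fun _ _ ↦ rfl
  -- the finite targets `T k = Sel ∩ H¹[p^k] ↪ Sel[p^k]`
  let T : ∀ k : ℕ, Set (W.subgroupH1 p U) := fun k ↦ {y | y ∈ Sel ∧ p ^ k • y = 0}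
  obtain ⟨D, -, hD⟩ := KolyvaginRankRigidity.exists_natCard_torsionBy_pow_le p hSel
  have hTinj : ∀ k : ℕ, ∃ j : T k → (↥Sel)[((p ^ k : ℕ) : ℤ)], Function.Injective j := fun k ↦
    ⟨fun y ↦ ⟨⟨y.1, y.2.1⟩, AddSubgroup.torsionBy.nsmul_iff.mpr (Subtype.ext (by
        rw [AddSubgroupClass.coe_nsmul, ZeroMemClass.coe_zero]; exact y.2.2))⟩,
      fun a b h ↦ Subtype.ext (congrArg (fun z : (↥Sel)[((p ^ k : ℕ) : ℤ)] ↦ ((z : Sel) : W.subgroupH1 p U)) h)⟩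
  have hTfin : ∀ k, Finite (T k) := fun k ↦ by
    haveI := finite_torsionBy_pow (↥Sel) p k
    obtain ⟨j, hj⟩ := hTinj k
    exact Finite.of_injective j hj
  have hTcard : ∀ k, Nat.card (T k) ≤ D * p ^ (zpCorank Sel p * k) := fun k ↦ by
    haveI := finite_torsionBy_pow (↥Sel) p k
    obtain ⟨j, hj⟩ := hTinj k
    exact (Nat.card_le_card_of_injective j hj).trans (hD k)
  refine rank_le_of_card_image_le (fun y hy ↦ htf 1 y (by rwa [pow_one]))
    (fun x hx ↦ Kato2004.eq_zero_of_forall_mem_pow_smul W p U x hx) S f T hTfin (zpCorank Sel p) D hTcard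
    ?_ ?_
  · -- values in `T k`
    intro k x
    refine ⟨hmem k x x.2, ?_⟩
    rw [hf_apply, ← map_nsmul, pow_smul_torsionH1_eq_zero, map_zero]
  · -- kernel `⊆ p^k H¹(U, T_pW)`
    intro k x hx
    rw [hf_apply] at hx
    have h0 : reduceH1Pk W p k U (x : H1 (tateRep W p) U) = 0 :=
      (injective_iff_map_eq_zero (ι k)).mp (hιinj k) _ hx
    exact (KatoFiniteLevelCount.reduceH1Pk_eq_zero_iff W p k U _).mp h0

/-- **The comparison at the layers of a `ℤ_p`-extension with `E(ℚ_∞)[p^∞] = 0`.** For a `ℤ_p`-extension `κ` of `ℚ` such that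
`E[p^∞]` has no non-zero point fixed by `Gal(ℚ̄/ℚ_∞)`, every layer `n`, every `ℤ_p`-submodule `S ⊆ H¹(ℚ_n, T_pW)` and every
`p`-primary `Sel ≤ H¹(ℚ_n, E[p^∞])` with `Sel[p]` finite receiving all pushed reductions of `S`:
`Module.rank ℤ_[p] S ≤ zpCorank Sel p`. (`H¹(ℚ_n, T_pW)` is torsion-free by
`TowerVanishing.layerH1_eq_zero_of_pow_smul_eq_zero_of_fixedPoints_eq_bot`; a `Gal(ℚ̄/ℚ_n)`-fixed point is `Gal(ℚ̄/ℚ_∞)`-fixed.)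
[cite: GreenbergVatsal2000, §2 Prop. (2.1)] [cite: GreenbergLNM1716, §1 p. 60 and §3 Lemma 3.1] -/
theorem rank_le_zpCorank_of_forall_reduceH1Pk_mem_layer (κ : ZpExtension ℚ p)
    (hfix : FixedPoints.addSubgroup κ.kerSubgroup (↥(W.geomPrimaryTorsion p)) = ⊥) (n : ℕ)
    (S : Submodule ℤ_[p] (H1 (tateRep W p) (κ.layerSubgroup n)))
    (Sel : AddSubgroup (W.subgroupH1 p (κ.layerSubgroup n))) [Finite (↥Sel)[(p : ℤ)]]
    (hmem : ∀ (k : ℕ) (x : H1 (tateRep W p) (κ.layerSubgroup n)), x ∈ S →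
      resH1Hom (N := W.geomPrimaryTorsion p) (ContinuousMonoidHom.id (κ.layerSubgroup n))
        (AddSubgroup.inclusion (AcSigned.geomTorsion_zpow_le_geomPrimaryTorsion W p k)) (fun _ _ ↦ rfl)
        (reduceH1Pk W p k (κ.layerSubgroup n) x) ∈ Sel) :
    Module.rank ℤ_[p] S ≤ zpCorank Sel p := by
  refine rank_le_zpCorank_of_forall_reduceH1Pk_mem W p (κ.layerSubgroup n)
    (TowerVanishing.layerH1_eq_zero_of_pow_smul_eq_zero_of_fixedPoints_eq_bot W κ hfix n) (fun P hP ↦ ?_) S Sel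
    (fun s ↦ ?_) hmem
  · -- a `Gal(ℚ̄/ℚ_n)`-fixed point is `Gal(ℚ̄/ℚ_∞)`-fixed
    have hmemP : P ∈ FixedPoints.addSubgroup κ.kerSubgroup (↥(W.geomPrimaryTorsion p)) := by
      rw [FixedPoints.mem_addSubgroup]
      intro τ
      rw [Subgroup.smul_def]
      exact hP τ (κ.kerSubgroup_le_layerSubgroup n τ.2)
    rw [hfix, AddSubgroup.mem_bot] at hmemP
    exact hmemP
  · obtain ⟨k, hk⟩ := W.exists_pow_smul_subgroupH1_layer_eq_zero κ n (s : W.subgroupH1 p (κ.layerSubgroup n))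
    exact ⟨k, Subtype.ext (by rw [AddSubgroupClass.coe_nsmul, ZeroMemClass.coe_zero]; exact hk)⟩

end General

section Signed

variable {K : Type u} [Field K] [NumberField K] (W : WeierstrassCurve K) [W.IsElliptic] {p : ℕ} [Fact p.Prime]
  (κ : ZpExtension K p) (ε : ℤˣ) {γ : absoluteGaloisGroup K}

/-- **`Sel^ε(E/K_n)[p]` is finite** — any number field `K`, prime `p`, `ℤ_p`-extension `κ` with topological generator `γ`, sign
`ε`, signed dual datum `D` with `X^ε` finitely generated torsion and `μ = 0`, and `E(K)[p] = 0`: `Sel^ε(E/K_n)` embeds in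
`Sel^ε(E/K_∞)` (`TowerHaMa.layerToInfty_injective_of_no_pTorsion`), whose `p`-torsion is finite
(`SignedTransportAtTwo.finite_torsionBy_signedSelmerInfty`). [cite: GreenbergLNM1716, §1 p. 60 and §3 Lemma 3.1]
[cite: Kobayashi2003, Def. 1.1] -/
theorem finite_torsionBy_signedSelmerLayer (hγ : κ.IsTopGenerator γ) (hK : ∀ P : W.toAffine.Point, p • P = 0 → P = 0)
    (D : SignedSelmerDualData W κ γ ε) [Module.Finite (IwasawaAlgebra p) D.X]
    (hT : Module.IsTorsion (IwasawaAlgebra p) D.X) (hμ : D.mu = 0) (n : ℕ) :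
    Finite (↥(signedSelmerLayer W κ ε n))[(p : ℤ)] := by
  let r : signedSelmerLayer W κ ε n →+ signedSelmerInfty W κ ε :=
    ((W.layerToInfty κ n).comp (signedSelmerLayer W κ ε n).subtype).codRestrict (signedSelmerInfty W κ ε)
      fun x ↦ map_layerToInfty_signedSelmerLayer_le W κ ε n ⟨x, x.2, rfl⟩
  have hr_coe : ∀ x : signedSelmerLayer W κ ε n,
      ((r x : signedSelmerInfty W κ ε) : W.subgroupH1 p κ.kerSubgroup) = W.layerToInfty κ n x := fun _ ↦ rfl
  have hr : Function.Injective r := fun x y h ↦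
    Subtype.ext (TowerHaMa.layerToInfty_injective_of_no_pTorsion W κ hγ hK n (by rw [← hr_coe, ← hr_coe, h]))
  haveI : Finite (↥(signedSelmerInfty W κ ε))[(p : ℤ)] :=
    SignedTransportAtTwo.finite_torsionBy_signedSelmerInfty W κ γ ε D hT hμ
  let j : (↥(signedSelmerLayer W κ ε n))[(p : ℤ)] → (↥(signedSelmerInfty W κ ε))[(p : ℤ)] := fun x ↦
    ⟨r x.1, AddSubgroup.torsionBy.nsmul_iff.mpr (by
      rw [← map_nsmul, AddSubgroup.torsionBy.nsmul_iff.mp x.2, map_zero])⟩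
  have hj : Function.Injective j := fun a b h ↦
    Subtype.ext (hr (congrArg (fun z : (↥(signedSelmerInfty W κ ε))[(p : ℤ)] ↦ (z : signedSelmerInfty W κ ε)) h))
  exact Finite.of_injective j hj

end Signed

/-- **(Λ3) at `p = 2` on the habitat, compact form: `rank_{ℤ₂} S ≤ λ⁺` for every `S ⊆ H¹(ℚ_n, T₂E)` reducing into `Sel⁺(E/ℚ_n)`.**
For `E/ℚ` globally minimal with good supersingular reduction at `2`, a `ℤ₂`-extension `κ` with topological generator `γ`, a `+`
signed dual datum `D` with `X⁺` finitely generated `Λ`-torsion and `μ = 0`, and every layer `n`: if `S` is a `ℤ₂`-submodule of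
`H¹(ℚ_n, T₂E)` all of whose reductions modulo `2^k`, pushed into `H¹(ℚ_n, E[2^∞])`, lie in `Sel⁺(E/ℚ_n)`, then
`Module.rank ℤ_[2] S ≤ λ(X⁺)` — the hypothesis `hB` (with `B = λ⁺`, uniform in `n`) of the engine
`TowerVanishing.forall_eq_zero_of_layerCores_eq_of_mem_of_rank_le_of_goodSS`. (`E(ℚ_∞)[2^∞] = 0`:
`SignedTransportAtTwo.fixedPoints_kerSubgroup_eq_bot_of_goodSS`; corank bound p645699.)
[cite: GreenbergVatsal2000, §2 Prop. (2.1)] [cite: Kobayashi2003, Def. 1.1] [cite: GreenbergLNM1716, §1 p. 60] -/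
theorem rank_le_lambda_of_forall_reduceH1Pk_mem_signedSelmerLayer_of_goodSS {E : WeierstrassCurve ℚ} [E.IsElliptic]
    [E.IsGloballyMinimal] [ContinuousSMul ℤ_[2] (E.tateModule 2)] (hss : Rank1Residual.GoodSS E 2) (κ : ZpExtension ℚ 2)
    {γ : absoluteGaloisGroup ℚ} (hγ : κ.IsTopGenerator γ) (D : SignedSelmerDualData E κ γ 1)
    [Module.Finite (IwasawaAlgebra 2) D.X] (hT : Module.IsTorsion (IwasawaAlgebra 2) D.X) (hμ : D.mu = 0) (n : ℕ)
    (S : Submodule ℤ_[2] (H1 (tateRep E 2) (κ.layerSubgroup n)))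
    (hmem : ∀ (k : ℕ) (x : H1 (tateRep E 2) (κ.layerSubgroup n)), x ∈ S →
      resH1Hom (N := E.geomPrimaryTorsion 2) (ContinuousMonoidHom.id (κ.layerSubgroup n))
        (AddSubgroup.inclusion (AcSigned.geomTorsion_zpow_le_geomPrimaryTorsion E 2 k)) (fun _ _ ↦ rfl)
        (reduceH1Pk E 2 k (κ.layerSubgroup n) x) ∈ signedSelmerLayer E κ 1 n) :
    Module.rank ℤ_[2] S ≤ D.lambda := by
  haveI : Finite (↥(signedSelmerLayer E κ 1 n))[(2 : ℤ)] :=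
    finite_torsionBy_signedSelmerLayer (p := 2) E κ 1 hγ
      (fun P hP ↦ SignedTransportAtTwo.eq_zero_of_two_nsmul_eq_zero_of_goodSS E hss P (by convert hP)) D hT hμ n
  calc Module.rank ℤ_[2] S ≤ zpCorank (signedSelmerLayer E κ 1 n) 2 :=
        rank_le_zpCorank_of_forall_reduceH1Pk_mem_layer E 2 κ
          (SignedTransportAtTwo.fixedPoints_kerSubgroup_eq_bot_of_goodSS E hss κ) n S _ hmem
    _ ≤ D.lambda := by
        exact_mod_cast TowerVanishing.zpCorank_signedSelmerLayer_le_lambda_of_goodSS hss κ hγ D hT hμ n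

end Summit.BirchSwinnertonDyer.BirchSwinnertonDyer.Theorems.ResidualThetaLayer.CompactRank

end
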